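import Summits.BirchSwinnertonDyer.Rank1Residual.Additive.KatoDescentClosedBinders
import Literature.NumberTheory.EllipticCurves.KatoFineSelmerDualUniquenessProofs
import HarnessLib

/-!
# CLOSED binders for the Kato descent interface, v3 — the PRINT-EXACT, CONTRAGREDIENT twins
# `IsKatoZetaDescentDatumOfContra W p D` / `KatoMainConjectureFineContra W p` of
# `IsKatoZetaDescentDatumOf` / `KatoMainConjectureFine` (`KatoDescentClosedBinders.lean`, p612876): the dual fine
# Selmer group keyed `γ⁻¹` (`Y : W.FineSelmerDualData κ γ⁻¹`, its contragredient `Λ`-structure) against the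
# covariant `I : Kato2004.IwasawaH1Data W p κ γ` — seat bsd-cm-prr-ty1 g6, CONVENTION Q of planner D401/D403
# (cell bsd-cm; consumers: the Kato–Perrin-Riou skeletons of cruxes stmt-BirchSwinnertonDyer-19945 / -19223,
# cell bsd-potss's `…OfKMCFine` theorems)

WHAT. Two DEFINITIONS (one `@[conjecture]`) and their kernel lemmas, the exact analogues of §§1–3 of
`KatoDescentClosedBinders.lean` with ONE change: wherever that file compares lengths with the key-`γ` datum
`(W.fineSelmerDualData κ hγ).X` (the CONSTRUCTED dual fine Selmer group with `1 + T` acting as `x ↦ x ∘ conj_γ`),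
this file compares with ANY datum `Y : W.FineSelmerDualData κ γ⁻¹` of key `γ⁻¹` (`1 + T` acting as
`x ↦ x ∘ conj_{γ⁻¹}`, the CONTRAGREDIENT structure; one exists, `WeierstrassCurve.nonempty_fineSelmerDualData'`, and
all are `Λ`-isomorphic, `FineSelmerDualData.nonempty_linearEquiv`, so «∀ Y» = «for the contragredient `X₀`»,
`forall_fineSelmerDualData_lengthAt_iff`). This is the keying of cell bsd-wall's print-exact Kato facts
(`Kato2004.thm13_4_lengthAt_fineSelmerDualContra_le_of_isEulerSystemClass`, `FB : W.FineSelmerDualData κ γ⁻¹` against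
`I : IwasawaH1Data W p κ γ`). Nothing in `KatoDescentClosedBinders.lean` is edited (D-0014 / append-only); the
relation between the two pairs — «v2 pair = this pair ∘ ι on the `X₀` side; equivalent iff `char_Λ X₀(ℚ_∞)` is
`ι`-symmetric prime by prime (unprinted)» — is PROVED in `Summits/…/Theorems/KatoDescentClosedBindersContraBridge.lean`
(this seat), from `Literature/…/Kato2004/IwasawaInvolutionTwistProofs.lean` (p626559).

CONVENTION (v3; read from the tree's DEFINITIONS, not from docstrings). `Λ = ℤ_p⟦T⟧` acts on
`I : Kato2004.IwasawaH1Data W p κ γ` by `T = conj_γ − 1` (`IwasawaH1Data.proj_T_smul`) with `conj_σ` the natural,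
covariant action `(σ·c)(h) = σ • c(σ⁻¹hσ)` (`GaloisRepresentations.conjMap`, `SubgroupSelmer.conjH1`) — Kato's
`ℤ_p[[Gal(ℚ_∞/ℚ)]]`-structure on `𝐇¹(T)`, `1 + T ↦ γ` [§12.2 p. 220]; on `Y : W.FineSelmerDualData κ γ'` it acts by
PRE-composition, `(T·x)(s) = x(conj_{γ'} s) − x(s)` (`FineSelmerDualData.toDual_T_smul`), i.e. `1 + T ↦ (x ↦ x ∘ conj_{γ'})`,
the CONTRAGREDIENT action of `γ'⁻¹`. Poitou–Tate duality is induced by a Galois-INVARIANT pairing, so it carries the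
natural action of `σ` on `𝐇²(T)₀` to `x ↦ x ∘ conj_{σ⁻¹}` on the Pontryagin dual `X₀ = Hom(Sel₀(ℚ_∞, W[p^∞]), ℚ/ℤ)`:
with `1 + T ↦ γ` on both sides, Kato's `𝐇²(T_pW)₀` IS the datum of key `γ' = γ⁻¹`, and the key-`γ` datum
`W.fineSelmerDualData κ hγ` of `KatoDescentClosedBinders.lean` §§1–2 is `(X₀)^ι`, `ι : T ↦ (1+T)⁻¹ − 1` [Greenberg 1989 pp. 101–102, "`S^ι`";
Greenberg LNM 1716 §1 p. 60] — the reading cell `bsd-wall` established for Kato's Thm. 13.4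
(`Kato2004/EulerSystemBoundFineSelmerContragredient.lean`, `G4-CONVENTION-AUDIT.md` + second reader) and the one of
`Literature/…/Kato2004/IwasawaInvolutionTwistProofs.lean` (this seat, g6: `ℓ_𝔮(Y') = ℓ_{ι𝔮}(Y)` for any data of keys
`γ⁻¹`/`γ`; the `ι`-twist of `IwasawaH2Data`). HENCE that file's `KatoMainConjectureFine W p` (its §2), which compares the key-`γ` datum
with `I.H/Λz₀` at the SAME `𝔮`, states «Kato 12.10 ∘ ι on the `X₀` side»: given Kato's 12.10 it holds iff
`char_Λ X₀(ℚ_∞)` is `ι`-symmetric prime by prime — an UNPRINTED statement (Greenberg 1989 Thm. 2 pairs the FINE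
condition with the RELAXED one under `ι`, not fine with fine; `ι` moves the generic height-one prime `(T − a)`,
`a ∈ pℤ_p`, to `(T + a/(1+a))`); and its §1 (H2) clause pins `P.J.H2` to the lengths of `𝐇²(T_pW)^ι`, not of `𝐇²(T_pW)`
(harmless for every layer-`0` count: `Γ`-invariants, `Γ`-coinvariants and `|char(0)|_p` of `M` and `M^ι` coincide, `ι`
fixing the augmentation). The twins of THIS file remove the `ι`: they are keyed `γ⁻¹`. The key-`γ⁻¹` datum exists for every `γ`
(`WeierstrassCurve.nonempty_fineSelmerDualData'`) and is unique up to `Λ`-isomorphism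
(`FineSelmerDualData.nonempty_linearEquiv`), so «∀ Y of key `γ⁻¹`» = «for the (any) contragredient `X₀`»
(`forall_fineSelmerDualData_lengthAt_iff`). The bridges «v2 pair ⟺ contragredient pair given the displayed `ι`-symmetry» and the
contragredient crux records live in `Summits/…/Theorems/KatoDescentClosedBindersContraBridge.lean` (this seat, g6).
[cite: Kato2004Asterisque, §12.2 (p. 220), (14.9.1) (p. 239), §17.13 (17.13.1) (p. 279)]
[cite: Greenberg1989, §0 pp. 101–102 (the Λ-module S^ι, ι(γ) = γ⁻¹, and Thm. 2)] [cite: GreenbergLNM1716, §1 p. 60]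

WHY (the soundness point, numbers not adjectives). The v2 `KatoMainConjectureFine W p` reads
«∀ height-one 𝔮: ℓ_𝔮((X₀)^ι) = ℓ_𝔮(𝐇¹_Γ/Λz₀)», i.e. Kato's Conj. 12.10 composed with `ι` on ONE side; Kato's own
statement [Conj. 12.10, p. 224: "`length_{Λ_𝔭}(𝐇²(T)_𝔭) = length_{Λ_𝔭}((𝐇¹(T)/Z(f,T))_𝔭)` for every height-one `𝔭`",
both `𝐇^q` with the natural `Λ = O_λ[[G_∞]]`-structure of §12.2] has no `ι`. The research stubs
`stub_katoMainConjectureFineSeven` (19945) / `stub_katoMainConjectureFineIstarZero` (19223) over the v2 name are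
therefore STRONGER THAN PRINT by the clause «`char_Λ X₀(ℚ_∞)` is `ι`-symmetric» (the same finding as cell bsd-wall's
on its K3 stub R2, STATUS 2026-08-28T01:50Z); over the names of this file they are print-exact. The (H2) clause of
the v2 `IsOf` pins `D.H2` to the lengths of `𝐇²(T_pW)^ι`; the (H2ᶜ) clause here pins it to those of `𝐇²(T_pW)` —
realised, under the named fact `Kato2004.exists_iwasawaH2Data_fineSelmerDual_embedding` (p624791) and local
finiteness, by `….lengthAt_eq_contra` (p626559: the fact's package twisted by `ι`). Every layer-`0` count (the
readings `DescentCountReading` / `RankOneCountReading`) is insensitive to the difference (`Γ`-invariants,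
`Γ`-coinvariants and `|char(0)|_p` agree on `M` and `M^ι`).

HONEST LABEL: two DEFINITIONS (one `@[conjecture]`) and kernel lemmas; no named fact, no instance, no notation, no
`sorry`; nothing about Kato's Main Conjecture, Perrin-Riou's conjecture or BSD is asserted; the readings of the
descent files instantiated at `(IsKatoZetaDescentDatumOfContra, Kato2004.PRRatio, KatoMainConjectureFineContra)` remain
DISPLAYED print hypotheses of the consumers (only the `→` half of `ReadsTrivialKMC` is proved here); SCOPE of
`KatoMainConjectureFineContra` = SCOPE of the v2 name (`p ≠ 2`; `W(ℚ_{p,∞})[p^∞]` finite — `0 ≤ v_p(j W)` by Imai, or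
`W` multiplicative at `p`; never Kato's exceptional `(W, 3)` of (12.5.1)).
[cite: Kato2004Asterisque, Conj. 12.10 (p. 224), §12.2 (p. 220), Thm. 12.4 (p. 221), Thm. 12.5 (3)–(4) with (12.5.1) (p. 222), §14.14 (14.14.1) (p. 243), (14.9.1) (p. 239), §17.13 (17.13.1) (p. 279)]
[cite: Greenberg1989, §0 pp. 101–102] [cite: GreenbergLNM1716, §1 p. 60] [cite: Kim2022StructureSelmer, Conj. 1.3] [cite: Imai1975, Theorem (p. 12)]
-/

noncomputable section

open scoped Classical

open WeierstrassCurve Field Literature.NumberTheory.EllipticCurves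
  Literature.NumberTheory.EllipticCurves.Kato2004 Literature.NumberTheory.EllipticCurves.IwasawaAlgebra
  Literature.NumberTheory.GaloisRepresentations
open Summit.BirchSwinnertonDyer.BirchSwinnertonDyer.Theorems.CongruentShaFreeCutKatoDescentDatumOfH2

namespace Summit.BirchSwinnertonDyer.Rank1Residual.Additive

/-! ## §1 The contragredient closed `IsOf` and `KMC` -/

/-- **`IsKatoZetaDescentDatumOfContra W p D` — «`D` IS Kato's §14.14 descent datum of `T_pW` on the `Δ`-trivial
component, zeta element included», PRINT-EXACT keying (v3)**: a v2 pin `P` (cn100) ∧ `P.eH D.z` is an ADMISSIBLE zeta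
class of `P.I` ∧ **(H2ᶜ)** the lengths of `P.J.H2` at height-one primes are those of the dual fine Selmer group
`X₀(ℚ_∞) = Hom(Sel₀(ℚ_∞, W[p^∞]), ℚ/ℤ)` IN ITS CONTRAGREDIENT `Λ`-STRUCTURE — every datum
`Y : W.FineSelmerDualData P.κ P.γ⁻¹` of key `γ⁻¹` (`1 + T ↦ (x ↦ x ∘ conj_{γ⁻¹})`, the structure Poitou–Tate duality
carries Kato's natural action on `𝐇²(T_pW)⁰` to; one exists and all are `Λ`-isomorphic) — which ARE the lengths of
Kato's genuine `𝐇²(T_pW)⁰` whenever `W(ℚ_{p,∞})[p^∞]` is finite (PRINT FOR (H2) in the module docstring of `KatoDescentClosedBinders.lean`;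
Kato (14.9.1) + (12.2.3) + Imai). Differs from `IsKatoZetaDescentDatumOf` (§1 there) exactly by the key (`γ` there = `(X₀)^ι`). A `Prop`;
nothing asserted.
[cite: Kato2004Asterisque, Thm. 12.4 (p. 221), Conj. 12.10 (p. 224), §14.14 (14.14.1) (p. 243), §12.2 (12.2.3) (p. 220), (14.9.1) (p. 239), §17.13 (17.13.1) (p. 279)]
[cite: Greenberg1989, §0 pp. 101–102] [cite: Imai1975, Theorem (p. 12)] -/
def IsKatoZetaDescentDatumOfContra (W : WeierstrassCurve ℚ) [W.IsElliptic] [W.IsGloballyMinimal] (p : ℕ)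
    [Fact p.Prime] (D : KatoDescentDatum p) : Prop :=
  letI : ContinuousSMul ℤ_[p] (W.tateModule p) := TateModule.continuousSMul_padicInt
  ∃ P : KatoDescentDatumPinH2 W p D,
    Kato2004.IsAdmissibleZetaClass W p P.κ P.isCyclotomic P.I (P.eH D.z) ∧
    ∀ (Y : W.FineSelmerDualData P.κ P.γ⁻¹) (𝔮 : PrimeSpectrum (IwasawaAlgebra p)), 𝔮.asIdeal.height = 1 →
      Module.lengthAt (IwasawaAlgebra p) P.J.H2 𝔮 = Module.lengthAt (IwasawaAlgebra p) Y.X 𝔮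

/-- **`KatoMainConjectureFineContra W p` — Kato's Main Conjecture 12.10 for `T = T_pW` on the `Δ`-trivial
component, `p` odd, in FINE-SELMER currency, CLOSED, PRINT-EXACT keying (v3)**: (∃ an admissible zeta class — the
integrality clause `Z(f,T)_𝔭 ⊂ 𝐇¹(T)_𝔭`) ∧ for every cyclotomic `(K, γ)` (`γ` the topological generator,
`1 + T ↦ γ`), pinned `𝐇¹_Γ(T_pW)` `I` (Kato's covariant `Λ`-structure), admissible `z₀ ∈ I.H`, dual fine Selmer
datum `Y` of key `γ⁻¹` (`X₀(ℚ_∞)` in its CONTRAGREDIENT `Λ`-structure = the structure of Kato's `𝐇²(T_pW)⁰` under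
Poitou–Tate) and height-one `𝔮`: `length_{Λ_𝔮} X₀(ℚ_∞)_𝔮 = length_{Λ_𝔮} (𝐇¹_Γ/Λz₀)_𝔮` AT THE SAME `𝔮` — Kato:
`length 𝐇²(T)_𝔭 = length (𝐇¹(T)/Z(f,T))_𝔭` verbatim. SCOPE as `KatoMainConjectureFine`'s (`p ≠ 2`; not at Kato's exceptional `(W, 3)` of
(12.5.1); `W(ℚ_{p,∞})[p^∞]` finite, e.g. `0 ≤ v_p(j W)` by Imai). Differs from `KatoMainConjectureFine` exactly by
the key of `X₀` (`γ` there, i.e. `(X₀)^ι`: that definition = this one ∘ `ι` on one side, equivalent to it iff `char_Λ X₀(ℚ_∞)` is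
`ι`-symmetric — unprinted); bridges in `Theorems/KatoDescentClosedBindersContraBridge.lean`. CONJECTURE (theorem for
`p ∤ 2N·…` in many cases — NOT at an additive `p`); `@[conjecture]`; nothing asserted.
[cite: Kato2004Asterisque, Conj. 12.10 (p. 224), §12.2 (p. 220), (14.9.1) (p. 239), Thm. 12.5 (3) with (12.5.1) (p. 222), §17.13 (17.13.1) (p. 279)]
[cite: Greenberg1989, §0 pp. 101–102] [cite: Kim2022StructureSelmer, Conj. 1.3] [cite: Imai1975, Theorem (p. 12)] -/
@[conjecture] def KatoMainConjectureFineContra (W : WeierstrassCurve ℚ) [W.IsElliptic] [W.IsGloballyMinimal]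
    (p : ℕ) : Prop :=
  ∀ hp : p.Prime,
    haveI : Fact p.Prime := ⟨hp⟩
    letI : ContinuousSMul ℤ_[p] (W.tateModule p) := TateModule.continuousSMul_padicInt
    (∃ (K : ZpExtension ℚ p) (hK : K.IsCyclotomic) (γ : absoluteGaloisGroup ℚ) (_ : K.IsTopGenerator γ)
        (I : IwasawaH1Data W p K γ) (z₀ : I.H), Kato2004.IsAdmissibleZetaClass W p K hK I z₀) ∧
    ∀ (K : ZpExtension ℚ p) (hK : K.IsCyclotomic) (γ : absoluteGaloisGroup ℚ) (_ : K.IsTopGenerator γ)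
      (I : IwasawaH1Data W p K γ) (z₀ : I.H), Kato2004.IsAdmissibleZetaClass W p K hK I z₀ →
      ∀ (Y : W.FineSelmerDualData K γ⁻¹) (𝔮 : PrimeSpectrum (IwasawaAlgebra p)), 𝔮.asIdeal.height = 1 →
        Module.lengthAt (IwasawaAlgebra p) Y.X 𝔮 =
          Module.lengthAt (IwasawaAlgebra p) (I.H ⧸ (IwasawaAlgebra p) ∙ z₀) 𝔮

/-! ## §2 Kernel lemmas -/

section LemmasContra

variable {W : WeierstrassCurve ℚ} [W.IsElliptic] [W.IsGloballyMinimal] {p : ℕ} [Fact p.Prime]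
  [ContinuousSMul ℤ_[p] (W.tateModule p)] {D : KatoDescentDatum p}

omit [W.IsElliptic] [W.IsGloballyMinimal] [ContinuousSMul ℤ_[p] (W.tateModule p)] in
/-- **«For ONE dual fine Selmer datum of key `γ'`» ⇔ «for ALL»**: a family of lengths agrees with those of some
`Y₀ : W.FineSelmerDualData κ γ'` at the height-one primes iff it agrees with those of every such `Y` (any two are
`Λ`-isomorphic, `FineSelmerDualData.nonempty_linearEquiv`; used with `γ' = γ⁻¹`).
[cite: GreenbergLNM1716, §1 (after Conj. 1.3)] -/
theorem forall_fineSelmerDualData_lengthAt_iff {κ : ZpExtension ℚ p} {γ' : absoluteGaloisGroup ℚ}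
    (Y₀ : W.FineSelmerDualData κ γ') (ℓ : PrimeSpectrum (IwasawaAlgebra p) → ℕ∞) :
    (∀ (Y : W.FineSelmerDualData κ γ') (𝔮 : PrimeSpectrum (IwasawaAlgebra p)), 𝔮.asIdeal.height = 1 →
        ℓ 𝔮 = Module.lengthAt (IwasawaAlgebra p) Y.X 𝔮) ↔
      ∀ 𝔮 : PrimeSpectrum (IwasawaAlgebra p), 𝔮.asIdeal.height = 1 →
        ℓ 𝔮 = Module.lengthAt (IwasawaAlgebra p) Y₀.X 𝔮 := by
  refine ⟨fun h 𝔮 h𝔮 ↦ h Y₀ 𝔮 h𝔮, fun h Y 𝔮 h𝔮 ↦ ?_⟩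
  obtain ⟨e⟩ := FineSelmerDualData.nonempty_linearEquiv Y Y₀
  rw [Module.lengthAt_eq_of_linearEquiv e 𝔮, h 𝔮 h𝔮]

/-- Unfolding of the contragredient closed `IsOf` (under any instance of the `Prop`-valued structure fact).
[cite: Kato2004Asterisque, §14.14 (14.14.1) (p. 243)] -/
theorem isKatoZetaDescentDatumOfContra_iff :
    IsKatoZetaDescentDatumOfContra W p D ↔
      ∃ P : KatoDescentDatumPinH2 W p D,
        Kato2004.IsAdmissibleZetaClass W p P.κ P.isCyclotomic P.I (P.eH D.z) ∧
        ∀ (Y : W.FineSelmerDualData P.κ P.γ⁻¹) (𝔮 : PrimeSpectrum (IwasawaAlgebra p)),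
          𝔮.asIdeal.height = 1 →
          Module.lengthAt (IwasawaAlgebra p) P.J.H2 𝔮 = Module.lengthAt (IwasawaAlgebra p) Y.X 𝔮 :=
  Iff.rfl

/-- A witness gives the contragredient closed `IsOf` (any instance).
[cite: Kato2004Asterisque, §14.14 (14.14.1) (p. 243)] -/
theorem isKatoZetaDescentDatumOfContra_of_pin (P : KatoDescentDatumPinH2 W p D)
    (hz : Kato2004.IsAdmissibleZetaClass W p P.κ P.isCyclotomic P.I (P.eH D.z))
    (hH2 : ∀ (Y : W.FineSelmerDualData P.κ P.γ⁻¹) (𝔮 : PrimeSpectrum (IwasawaAlgebra p)),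
      𝔮.asIdeal.height = 1 →
      Module.lengthAt (IwasawaAlgebra p) P.J.H2 𝔮 = Module.lengthAt (IwasawaAlgebra p) Y.X 𝔮) :
    IsKatoZetaDescentDatumOfContra W p D :=
  isKatoZetaDescentDatumOfContra_iff.mpr ⟨P, hz, hH2⟩

/-- **The ONE-datum constructor of the contragredient closed `IsOf`**: a pin `P`, admissibility of `P.eH D.z`,
and the (H2ᶜ) lengths against a SINGLE dual fine Selmer datum `Y` of key `P.γ⁻¹` (e.g. the output of
`Kato2004.exists_iwasawaH2Data_fineSelmerDual_embedding.lengthAt_eq_contra`) suffice.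
[cite: Kato2004Asterisque, §14.14 (14.14.1) (p. 243), (14.9.1) (p. 239)] [cite: GreenbergLNM1716, §1 (after Conj. 1.3)] -/
theorem isKatoZetaDescentDatumOfContra_of_pin_of_fineSelmerDualData (P : KatoDescentDatumPinH2 W p D)
    (hz : Kato2004.IsAdmissibleZetaClass W p P.κ P.isCyclotomic P.I (P.eH D.z))
    (Y : W.FineSelmerDualData P.κ P.γ⁻¹)
    (hH2 : ∀ 𝔮 : PrimeSpectrum (IwasawaAlgebra p), 𝔮.asIdeal.height = 1 →
      Module.lengthAt (IwasawaAlgebra p) P.J.H2 𝔮 = Module.lengthAt (IwasawaAlgebra p) Y.X 𝔮) :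
    IsKatoZetaDescentDatumOfContra W p D :=
  isKatoZetaDescentDatumOfContra_of_pin P hz ((forall_fineSelmerDualData_lengthAt_iff Y _).mpr hH2)

omit [ContinuousSMul ℤ_[p] (W.tateModule p)] in
/-- The contragredient closed `IsOf` refines cn100's v2 pin: every reading proved over `IsKatoDescentDatumOfH2`
applies. [cite: Kato2004Asterisque, §14.14 (14.14.1) (p. 243)] -/
theorem IsKatoZetaDescentDatumOfContra.isKatoDescentDatumOfH2 (h : IsKatoZetaDescentDatumOfContra W p D) :
    IsKatoDescentDatumOfH2 W p D := by
  obtain ⟨P, -, -⟩ := h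
  exact ⟨P⟩

omit [ContinuousSMul ℤ_[p] (W.tateModule p)] in
/-- The contragredient closed `IsOf` forces `p ≠ 2`. [cite: Kato2004Asterisque, Thm. 12.5 (4) (p. 222) (`p ≠ 2`)] -/
theorem IsKatoZetaDescentDatumOfContra.ne_two (h : IsKatoZetaDescentDatumOfContra W p D) : p ≠ 2 := by
  letI : ContinuousSMul ℤ_[p] (W.tateModule p) := TateModule.continuousSMul_padicInt
  obtain ⟨P, hz, -⟩ := h
  exact Kato2004.ne_two_of_isAdmissibleZetaClass hz

omit [ContinuousSMul ℤ_[p] (W.tateModule p)] in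
/-- **The `→` half of the interface reading `ReadsTrivialKMC` at the contragredient closed binders, KERNEL:** on a
datum realising `IsKatoZetaDescentDatumOfContra`, `KatoMainConjectureFineContra` gives Kato's Conj. 12.10 for the
datum (`D.Conj1210`): apply the ∀-clause to the datum's own `(P.κ, P.γ, P.I, P.eH D.z)` and any dual fine Selmer
datum `Y` of key `P.γ⁻¹` (`nonempty_fineSelmerDualData'`), and transport lengths along `P.eH2 : D.H2 ≃ P.J.H2` and
`D.H/ΛD.z ≃ P.I.H/Λ(P.eH D.z)`. [cite: Kato2004Asterisque, Conj. 12.10 (p. 224)] -/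
theorem conj1210_of_isKatoZetaDescentDatumOfContra_of_katoMainConjectureFineContra
    (h : IsKatoZetaDescentDatumOfContra W p D) (hKMC : KatoMainConjectureFineContra W p) : D.Conj1210 := by
  letI : ContinuousSMul ℤ_[p] (W.tateModule p) := TateModule.continuousSMul_padicInt
  obtain ⟨P, hz, hH2⟩ := h
  obtain ⟨-, hall⟩ := hKMC Fact.out
  obtain ⟨Y⟩ := W.nonempty_fineSelmerDualData' P.κ P.γ⁻¹
  intro 𝔮 h𝔮
  have h1 := hall P.κ P.isCyclotomic P.γ P.isTopGenerator P.I (P.eH D.z) hz Y 𝔮 h𝔮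
  have hmap : ((IwasawaAlgebra p) ∙ D.z).map (P.eH : D.H →ₗ[IwasawaAlgebra p] P.I.H) =
      (IwasawaAlgebra p) ∙ (P.eH D.z) := by
    rw [Submodule.map_span, Set.image_singleton]; rfl
  have e₁ : (D.H ⧸ (IwasawaAlgebra p) ∙ D.z) ≃ₗ[IwasawaAlgebra p] (P.I.H ⧸ (IwasawaAlgebra p) ∙ (P.eH D.z)) :=
    Submodule.Quotient.equiv _ _ P.eH hmap
  rw [Module.lengthAt_eq_of_linearEquiv P.eH2 𝔮, Module.lengthAt_eq_of_linearEquiv e₁ 𝔮, hH2 Y 𝔮 h𝔮, h1]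

/-- **`KatoMainConjectureFineContra` is NOT vacuously true at `p = 2`** (∃-conjunct): `¬ KatoMainConjectureFineContra W 2`.
[cite: Kato2004Asterisque, Conj. 12.10 (p. 224) (`𝔭 ∌ 2`)] -/
theorem not_katoMainConjectureFineContra_two (W : WeierstrassCurve ℚ) [W.IsElliptic] [W.IsGloballyMinimal] :
    ¬ KatoMainConjectureFineContra W 2 := by
  intro h
  haveI : Fact (Nat.Prime 2) := ⟨Nat.prime_two⟩
  letI : ContinuousSMul ℤ_[2] (W.tateModule 2) := TateModule.continuousSMul_padicInt
  obtain ⟨⟨K, hK, γ, _, I, z₀, hz⟩, -⟩ := h Nat.prime_two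
  exact Kato2004.not_isAdmissibleZetaClass_two W K hK I z₀ hz

end LemmasContra

end Summit.BirchSwinnertonDyer.Rank1Residual.Additive

end
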